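import Mathlib
import HarnessLib
import Literature.NumberTheory.LFunctions.HorocycleRH
import Literature.NumberTheory.LFunctions.HorocycleRHProofs
import Literature.NumberTheory.LFunctions.HorocycleRateHalf
import Literature.NumberTheory.LFunctions.HorocycleRateHalfProofs
import Literature.NumberTheory.LFunctions.HorocycleRateHalfUnfolding
import Literature.NumberTheory.LFunctions.HorocycleRateHalfArcBound
import Literature.NumberTheory.LFunctions.HorocycleArcCoeffDeriv
import Literature.NumberTheory.LFunctions.HorocycleZeroModeQuasiRH
import Literature.NumberTheory.LFunctions.MoebiusDilatedSums
import Literature.NumberTheory.LFunctions.CoprimeResidueSums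
import Literature.NumberTheory.LFunctions.HorocycleZeroKernel

/-!
# Quasi-RH ⇒ power-saving equidistribution of closed horocycles: proof of `horocycleRate_of_quasiRH`

Discharge of the named fact `Literature.NumberTheory.LFunctions.horocycleRate_of_quasiRH`
(`HorocycleRH.lean`; Zagier 1981, §1 p. 279, (Z1): if `ζ(s) ≠ 0` for `Re s > Θ` then every
smooth `SL(2,ℤ)`-invariant cusp-supported `F` has horocycle averages
`∫₀¹ F(x+iy) dx = c + O(y^{1-Θ/2-ε})`; in the abscissa form of the route's dictionary,
`QuasiRiemannHypothesis (2 - 2θ) → HorocycleRate θ` for `1/2 ≤ θ ≤ 3/4`).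

Zagier's printed proof (and Sarnak's) uses the meromorphic continuation of the Eisenstein series
`E(z,s)` (Rankin–Selberg: the Mellin transform of the horocycle average is `∫ F E(·,s)`, whose
poles in `0 < Re s < 1` are at `ρ/2`), which Mathlib does not have. The proof given here is the
ELEMENTARY one already organised in the tree for the unconditional rate `O(y^{1/2})`
(`HorocycleRateHalf.lean`): unfolding of `Γ∞\Γ/Γ∞` on the closed horocycle and Fourier analysis
on the arcs reduce the horocycle average to
`2y ∑_{c ≤ N} ∑_{a mod c}^* Φ_g(c²y, a/c) = 2y ∑_c ∑_{d∣c} μ(d) (c/d) ∑_j b_{j c/d}(c²y)`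
(`horocycleUnfolding_holds`, `CoprimeResidueSums.sum_coprime_eq` — Ramanujan sums), and the
location of the zeros of `ζ` enters only through the Möbius function: under
`QuasiRiemannHypothesis θ₀` one has `M(x) = ∑_{n ≤ x} μ(n) = O(x^{θ₀+ε})` (tree,
`mertens_isBigO_of_quasiRiemannHypothesis_holds`, Titchmarsh Thm. 14.25), and partial
summation of this bound against the coefficients gives the power saving:

* the zero mode `2y ∑_c φ(c) b₀(c²y) = 2√y ∑_c (φ(c)/c) k₀(c√y)` is
  `2 (∑ μ(d)/d²) ∫k₀ + O(y^{1-α/2})` by `HorocycleZeroModeQuasiRH.zeroMode_bound_rpow`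
  (`α = θ₀ + ε`);
* the modes `k = je ≠ 0` contribute `2y ∑_e e ∑_{j ≠ 0} ∑_d μ(d) b_{je}(d²e²y)`, and Abel summation
  (`MoebiusDilatedSums.norm_sum_moebius_mul_le`) with the derivative bound
  `‖b_k'(w)‖ ≤ C/(|k|³ w)` (`HorocycleArcCoeffDeriv.exists_bound_hasDerivAt_arcCoeff`) gives
  `∑_d μ(d) b_k(d²w') = O(|k|⁻³ w'^{-α/2})`, hence a total `O(y^{1-α/2})`.

With `θ₀ = 2 - 2θ` and `α = 2 - 2θ + ε'` this is `O(y^{θ-ε'/2})`; the endpoint `θ = 1/2`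
(vacuous hypothesis) is the tree's unconditional `horocycleRate_half`.

## Main results
* `Literature.NumberTheory.LFunctions.HorocycleRHQuasiRH.rate_core` — the rate `O(y^{1-α/2})` for
  the unfolded horocycle average of a strip test function `g`, from `|M(t)| ≤ C t^α`
  (`1/2 ≤ α < 1`).
* `Literature.NumberTheory.LFunctions.horocycleRate_of_quasiRH_holds` — the discharge.
* `Literature.NumberTheory.LFunctions.horocycle_rate_iff_quasiRH`,
  `Literature.NumberTheory.LFunctions.horocycleRate_threeQuarters_iff_riemannHypothesis` — the
  dictionary `HorocycleRate θ ↔ QuasiRH (2-2θ)` and Zagier's criterion `HorocycleRate (3/4) ↔ RH`,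
  now unconditional theorems of the tree (both directions discharged).

## References
* D. Zagier, *Eisenstein series and the Riemann zeta function*, in: Automorphic forms,
  representation theory and arithmetic (Bombay 1979), Springer 1981, 275–301, §1 pp. 279–280
  [Zagier1981].
* P. Sarnak, *Asymptotic behavior of periodic orbits of the horocycle flow and Eisenstein
  series*, Comm. Pure Appl. Math. 34 (1981), 719–739, Thm. 1 [Sarnak1981].
* E. C. Titchmarsh, *The Theory of the Riemann Zeta-Function*, 2nd ed. (1986), Thm. 14.25
  [Titchmarsh1986].
* H. Iwaniec, *Spectral Methods of Automorphic Forms*, 2nd ed. (2002), §2.4, §3.4 [Iwaniec2002].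
-/

noncomputable section

open Real Complex MeasureTheory Set Filter Finset Asymptotics
open scoped ArithmeticFunction.Moebius Topology

namespace Literature.NumberTheory.LFunctions

namespace HorocycleRHQuasiRH

open HorocycleArcCoeffDeriv HorocycleZeroModeQuasiRH MoebiusDilatedSums

variable {Y₁ : ℝ} {g : ℂ → ℂ}

/-! ### The Fourier expansion of the arc transform in terms of `arcCoeff` -/

/-- `Φ_g(w,θ) = ∑_k b_k(w) e(kθ)` with `b_k = arcCoeff g k` (`w > 0`). [folklore] -/
theorem hasSum_arcTransform (hg : IsStripFun Y₁ g) {w : ℝ} (hw : 0 < w) (θ : ℝ) :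
    HasSum (fun k : ℤ => arcCoeff g k w * Complex.exp (2 * π * I * k * θ)) (arcTransform g w θ) := by
  rw [arcTransform_eq_integral_hpt g hw.ne' θ]
  have h := HorocyclePhase.hasSum_integral_apply_hpt hg.contDiff hg.periodic hg.supp'
    (a := 1 / 2) (b := max Y₁ (1 / 2)) (by norm_num) (le_max_right _ _) hw θ
  convert h using 1
  funext k
  rw [arcCoeff_eq_coeff hg hw k]

/-- `∑_k |b_k(w)| < ∞`. [folklore] -/
theorem summable_arcCoeff (hg : IsStripFun Y₁ g) {w : ℝ} (hw : 0 < w) :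
    Summable fun k : ℤ => arcCoeff g k w := by
  have h := HorocyclePhase.summable_coeffPsi hg.contDiff hg.periodic hg.supp'
    (a := 1 / 2) (b := max Y₁ (1 / 2)) (by norm_num) (le_max_right _ _) hw
  convert h using 1
  funext k
  rw [arcCoeff_eq_coeff hg hw k]

/-- Removing the `j = 0` term keeps summability. [folklore] -/
theorem summable_ite_zero {f : ℤ → ℂ} (hf : Summable f) :
    Summable fun j : ℤ => if j = 0 then 0 else f j := by
  refine (hf.sub (hasSum_ite_eq (0 : ℤ) (f 0)).summable).congr fun j => ?_
  by_cases h : j = 0 <;> simp [h]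

/-- **The nonzero modes of a row**: `T_e(w) = ∑_{j ≠ 0} b_{je}(w)`. [folklore] -/
def tail (g : ℂ → ℂ) (e : ℕ) (w : ℝ) : ℂ :=
  ∑' j : ℤ, if j = 0 then 0 else arcCoeff g (j * e) w

/-- Summability of `j ↦ b_{je}(w)` (`e ≥ 1`). [folklore] -/
theorem summable_arcCoeff_mul (hg : IsStripFun Y₁ g) {w : ℝ} (hw : 0 < w) {e : ℕ} (he : 0 < e) :
    Summable fun j : ℤ => arcCoeff g (j * e) w :=
  (summable_arcCoeff hg hw).comp_injective (mul_left_injective₀ (by exact_mod_cast he.ne'))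

/-- **Sum over reduced residues of the arc transform**:
`∑_{a mod c}^* Φ_g(w, a/c) = φ(c) b₀(w) + ∑_{d ∣ c} μ(d) (c/d) T_{c/d}(w)` (Ramanujan sums,
`CoprimeResidueSums.sum_coprime_eq`, with the `j = 0` term split off). [folklore] -/
theorem sum_coprime_arcTransform (hg : IsStripFun Y₁ g) {w : ℝ} (hw : 0 < w) {c : ℕ} (hc : 0 < c) :
    ∑ a ∈ (Finset.range c).filter (fun a => Nat.Coprime c a), arcTransform g w ((a : ℝ) / c) =
      (Nat.totient c : ℂ) * arcCoeff g 0 w +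
        ∑ d ∈ c.divisors, (μ d : ℂ) * (((c / d : ℕ) : ℂ) * tail g (c / d) w) := by
  rw [CoprimeResidueSums.sum_coprime_eq (fun θ => hasSum_arcTransform hg hw θ) hc,
    CoprimeResidueSums.totient_eq_sum_moebius_mul_div c hc, Finset.sum_mul, ← Finset.sum_add_distrib]
  refine Finset.sum_congr rfl fun d hd => ?_
  have hd0 : 0 < d := Nat.pos_of_mem_divisors hd
  have hdc : d ∣ c := Nat.dvd_of_mem_divisors hd
  have he0 : 0 < c / d := Nat.div_pos (Nat.le_of_dvd hc hdc) hd0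
  have hsplit := (summable_arcCoeff_mul hg hw he0).tsum_eq_add_tsum_ite 0
  simp only [zero_mul] at hsplit
  rw [hsplit]
  unfold tail
  ring

/-- **Rearrangement** `∑_{c ≤ N} ∑_{d ∣ c} μ(d) (c/d) T_{c/d}(c²y) = ∑_{e ≤ N} ∑_{d ≤ N/e} μ(d) e T_e((ed)²y)`.
[folklore] -/
theorem sum_sum_divisors_eq (y : ℝ) (N : ℕ) :
    ∑ c ∈ Finset.Ioc 0 N, ∑ d ∈ c.divisors,
        (μ d : ℂ) * (((c / d : ℕ) : ℂ) * tail g (c / d) ((c : ℝ) ^ 2 * y)) =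
      ∑ e ∈ Finset.Ioc 0 N, ∑ d ∈ Finset.Ioc 0 (N / e),
        (μ d : ℂ) * ((e : ℂ) * tail g e (((e * d : ℕ) : ℝ) ^ 2 * y)) := by
  set G : ℕ → ℕ → ℂ := fun e d => (μ d : ℂ) * ((e : ℂ) * tail g e (((e * d : ℕ) : ℝ) ^ 2 * y))
    with hG
  have h1 : ∀ c ∈ Finset.Ioc 0 N, ∑ d ∈ c.divisors,
      (μ d : ℂ) * (((c / d : ℕ) : ℂ) * tail g (c / d) ((c : ℝ) ^ 2 * y)) =
      ∑ x ∈ c.divisorsAntidiagonal, G x.1 x.2 := by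
    intro c _
    rw [Nat.sum_divisorsAntidiagonal' (f := G)]
    refine Finset.sum_congr rfl fun d hd => ?_
    rw [hG]; dsimp only
    rw [Nat.div_mul_cancel (Nat.dvd_of_mem_divisors hd)]
  rw [Finset.sum_congr rfl h1, HorocycleZeroMode.sum_Ioc_sum_divisorsAntidiagonal G N]

/-! ### Möbius cancellation in one mode: `∑_d μ(d) b_k(d² w') = O(|k|⁻³ w'^{-α/2})` -/

/-- **One mode.** From `|M(t)| ≤ C_M t^α` (`t ≥ 1`) and `‖b_k'(w)‖ ≤ C_b/(|k|³ w)`: for `k ≠ 0`,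
`w' > 0` and `n + 1 ≥ √(2/w')`,
`‖∑_{1 ≤ d ≤ n} μ(d) b_k(d² w')‖ ≤ (2 C_M C_b/α) (2/w')^{α/2} / |k|³`
(Abel summation, `MoebiusDilatedSums.norm_sum_moebius_mul_le`, with `F(t) = b_k(t² w')`,
`‖F'(t)‖ ≤ 2C_b/(|k|³ t)`, `F = 0` on `[√(2/w'), ∞)`; for `w' > 2` the sum is empty). [folklore] -/
theorem norm_sum_moebius_arcCoeff_le (hg : IsStripFun Y₁ g) {C_b : ℝ} (hCb0 : 0 ≤ C_b)
    (hCb : ∀ k : ℤ, k ≠ 0 → ∀ w : ℝ, 0 < w →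
      ∃ D : ℂ, HasDerivAt (arcCoeff g k) D w ∧ ‖D‖ ≤ C_b / (|(k : ℝ)| ^ 3 * w))
    {C_M α : ℝ} (hCM : 0 ≤ C_M) (hα0 : 0 < α)
    (hM : ∀ t : ℝ, 1 ≤ t → |∑ n ∈ Finset.Icc 0 ⌊t⌋₊, (μ n : ℝ)| ≤ C_M * t ^ α)
    {k : ℤ} (hk : k ≠ 0) {w' : ℝ} (hw' : 0 < w') {n : ℕ} (hn : Real.sqrt (2 / w') ≤ n + 1) :
    ‖∑ d ∈ Finset.Ioc 0 n, (μ d : ℂ) * arcCoeff g k ((d : ℝ) ^ 2 * w')‖ ≤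
      (2 * C_M * C_b / α) * (2 / w') ^ (α / 2) / |(k : ℝ)| ^ 3 := by
  have hk0 : (0 : ℝ) < |(k : ℝ)| := abs_pos.mpr (Int.cast_ne_zero.mpr hk)
  set X : ℝ := Real.sqrt (2 / w') with hX
  have hX0 : 0 ≤ X := Real.sqrt_nonneg _
  have hX2 : X ^ 2 = 2 / w' := Real.sq_sqrt (by positivity)
  have hXα : X ^ α = (2 / w') ^ (α / 2) := by
    rw [hX, Real.sqrt_eq_rpow, ← Real.rpow_mul (by positivity)]
    congr 1; ring
  -- the profile and its derivative
  set F : ℝ → ℂ := fun t => arcCoeff g k (t ^ 2 * w') with hF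
  set F' : ℝ → ℂ := fun t => ((2 * t * w' : ℝ) : ℂ) * deriv (arcCoeff g k) (t ^ 2 * w') with hF'
  have hFd : ∀ t : ℝ, 0 < t → HasDerivAt F (F' t) t ∧ ‖F' t‖ ≤ (2 * C_b / |(k : ℝ)| ^ 3) / t := by
    intro t ht
    have hw : 0 < t ^ 2 * w' := by positivity
    obtain ⟨D, hD, hDle⟩ := hCb k hk _ hw
    have hDd : deriv (arcCoeff g k) (t ^ 2 * w') = D := hD.deriv
    have h1 : HasDerivAt (fun t : ℝ => t ^ 2 * w') (2 * t * w') t := by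
      simpa using (hasDerivAt_pow 2 t).mul_const w'
    have h2 := hD.scomp t h1
    simp only [Function.comp_def, Complex.real_smul] at h2
    refine ⟨?_, ?_⟩
    · rw [hF, hF']; simpa [hDd] using h2
    · rw [hF']; dsimp only
      rw [hDd, norm_mul, Complex.norm_real, Real.norm_of_nonneg (by positivity)]
      calc 2 * t * w' * ‖D‖ ≤ 2 * t * w' * (C_b / (|(k : ℝ)| ^ 3 * (t ^ 2 * w'))) := by gcongr
        _ = (2 * C_b / |(k : ℝ)| ^ 3) / t := by field_simp
  have hFX : ∀ t : ℝ, X ≤ t → F t = 0 := fun t ht => by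
    rw [hF]; dsimp only
    apply arcCoeff_eq_zero_of_two_le hg k
    have : X ^ 2 ≤ t ^ 2 := by gcongr
    rw [hX2, div_le_iff₀ hw'] at this
    linarith
  -- complete the sum to `d ≤ n + 1` (the extra term vanishes) and pass to Abel's shape
  have hlast : F (n + 1 : ℕ) = 0 := hFX _ (by exact_mod_cast hn)
  have hshape : ∑ d ∈ Finset.Ioc 0 n, (μ d : ℂ) * arcCoeff g k ((d : ℝ) ^ 2 * w') =
      ∑ d ∈ Finset.Icc 0 (n + 1), F d * (μ d : ℂ) := by
    rw [Finset.Icc_eq_cons_Ioc (Nat.zero_le _), Finset.sum_cons, Finset.sum_Ioc_succ_top (Nat.zero_le _),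
      hlast]
    simp only [ArithmeticFunction.map_zero, Int.cast_zero, mul_zero, zero_add, zero_mul, add_zero]
    exact Finset.sum_congr rfl fun d _ => by rw [hF, mul_comm]
  rw [hshape]
  rcases le_or_gt X 1 with hX1 | hX1
  · -- `w' ≥ 2`: every term vanishes
    have : ∑ d ∈ Finset.Icc 0 (n + 1), F d * (μ d : ℂ) = 0 := by
      refine Finset.sum_eq_zero fun d hd => ?_
      rcases Nat.eq_zero_or_pos d with rfl | hd0
      · simp
      · rw [hFX d (hX1.trans (by exact_mod_cast hd0)), zero_mul]
    rw [this, norm_zero]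
    positivity
  · have hb := norm_sum_moebius_mul_le (F := F) (F' := F') hCM hα0 hM
      (fun t ht => (hFd t (by linarith)).1) (by positivity) (fun t ht => (hFd t (by linarith)).2)
      hX1.le hFX (n := n + 1) (by exact_mod_cast hn)
    refine hb.trans (le_of_eq ?_)
    rw [hXα]
    field_simp

/-- `∑_{j ≠ 0} |j|⁻³ ≤ 4` (crudely, through `∑_j 1/j² ≤ 4`). [folklore] -/
theorem tsum_inv_abs_cube_le : ∑' j : ℤ, (if j = 0 then (0 : ℝ) else 1 / |(j : ℝ)| ^ 3) ≤ 4 := by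
  have h4 := CoprimeResidueSums.tsum_one_div_int_sq_le
  have hs : Summable fun j : ℤ => 1 / ((j : ℝ)) ^ 2 := Real.summable_one_div_int_pow.mpr one_lt_two
  refine le_trans (Summable.tsum_le_tsum (fun j => ?_) ?_ hs) h4
  · split_ifs with hj
    · positivity
    · have hj1 : (1 : ℝ) ≤ |(j : ℝ)| := by
        rw [← Int.cast_abs]; exact_mod_cast Int.one_le_abs hj
      rw [← sq_abs (j : ℝ)]
      apply one_div_le_one_div_of_le (by positivity)
      calc |(j:ℝ)| ^ 2 = |(j:ℝ)| ^ 2 * 1 := by ring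
        _ ≤ |(j:ℝ)| ^ 2 * |(j:ℝ)| := by gcongr
        _ = |(j:ℝ)| ^ 3 := by ring
  · refine Summable.of_nonneg_of_le (fun j => ?_) (fun j => ?_) hs
    · split_ifs <;> positivity
    · split_ifs with hj
      · positivity
      · have hj1 : (1 : ℝ) ≤ |(j : ℝ)| := by
          rw [← Int.cast_abs]; exact_mod_cast Int.one_le_abs hj
        rw [← sq_abs (j : ℝ)]
        apply one_div_le_one_div_of_le (by positivity)
        calc |(j:ℝ)| ^ 2 = |(j:ℝ)| ^ 2 * 1 := by ring
          _ ≤ |(j:ℝ)| ^ 2 * |(j:ℝ)| := by gcongr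
          _ = |(j:ℝ)| ^ 3 := by ring

/-- **One row of nonzero modes.** For `e ≥ 1`, `0 < y`, `√(2/y) ≤ N`:
`‖∑_{d ≤ N/e} μ(d) e T_e((ed)²y)‖ ≤ (16 C_M C_b/α) e⁻² y^{-α/2}`. [folklore] -/
theorem norm_row_tail_le (hg : IsStripFun Y₁ g) {C_b : ℝ} (hCb0 : 0 ≤ C_b)
    (hCb : ∀ k : ℤ, k ≠ 0 → ∀ w : ℝ, 0 < w →
      ∃ D : ℂ, HasDerivAt (arcCoeff g k) D w ∧ ‖D‖ ≤ C_b / (|(k : ℝ)| ^ 3 * w))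
    {C_M α : ℝ} (hCM : 0 ≤ C_M) (hα0 : 0 < α) (hα1 : α ≤ 1)
    (hM : ∀ t : ℝ, 1 ≤ t → |∑ n ∈ Finset.Icc 0 ⌊t⌋₊, (μ n : ℝ)| ≤ C_M * t ^ α)
    {y : ℝ} (hy : 0 < y) {N : ℕ} (hN : Real.sqrt (2 / y) ≤ N) {e : ℕ} (he : 0 < e) :
    ‖∑ d ∈ Finset.Ioc 0 (N / e), (μ d : ℂ) * ((e : ℂ) * tail g e (((e * d : ℕ) : ℝ) ^ 2 * y))‖ ≤
      (16 * C_M * C_b / α) * ((e : ℝ) ^ 2)⁻¹ * y ^ (-(α / 2)) := by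
  have he0 : (0 : ℝ) < e := by exact_mod_cast he
  set w' : ℝ := (e : ℝ) ^ 2 * y with hw'
  have hw'0 : 0 < w' := by positivity
  -- rewrite the argument `(ed)² y = d² w'`
  have harg : ∀ d : ℕ, (((e * d : ℕ) : ℝ) ^ 2 * y) = (d : ℝ) ^ 2 * w' := fun d => by
    rw [hw']; push_cast; ring
  simp_rw [harg]
  -- pull out `e` and swap the finite sum with the sum over `j`
  have hsw : ∑ d ∈ Finset.Ioc 0 (N / e), (μ d : ℂ) * ((e : ℂ) * tail g e ((d : ℝ) ^ 2 * w')) =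
      (e : ℂ) * ∑' j : ℤ, (if j = 0 then 0 else
        ∑ d ∈ Finset.Ioc 0 (N / e), (μ d : ℂ) * arcCoeff g (j * e) ((d : ℝ) ^ 2 * w')) := by
    have hsum : ∀ d ∈ Finset.Ioc 0 (N / e), Summable fun j : ℤ =>
        (μ d : ℂ) * ((e : ℂ) * if j = 0 then 0 else arcCoeff g (j * e) ((d : ℝ) ^ 2 * w')) := by
      intro d hd
      have hd0 : (0 : ℝ) < d := by exact_mod_cast (Finset.mem_Ioc.mp hd).1
      exact ((summable_ite_zero (summable_arcCoeff_mul hg (by positivity) he)).mul_left _).mul_left _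
    have e1 : ∀ d ∈ Finset.Ioc 0 (N / e), (μ d : ℂ) * ((e : ℂ) * tail g e ((d : ℝ) ^ 2 * w')) =
        ∑' j : ℤ, (μ d : ℂ) * ((e : ℂ) * if j = 0 then 0 else arcCoeff g (j * e) ((d : ℝ) ^ 2 * w')) := by
      intro d hd
      unfold tail
      rw [tsum_mul_left, tsum_mul_left]
    rw [Finset.sum_congr rfl e1, ← Summable.tsum_finsetSum hsum, ← tsum_mul_left]
    refine tsum_congr fun j => ?_
    by_cases hj : j = 0
    · simp [hj]
    · simp only [hj, if_false, Finset.mul_sum]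
      exact Finset.sum_congr rfl fun d _ => by ring
  rw [hsw, norm_mul, Complex.norm_natCast]
  -- bound the `j`-sum termwise
  have hn : Real.sqrt (2 / w') ≤ (N / e : ℕ) + 1 := by
    have h1 : Real.sqrt (2 / w') = Real.sqrt (2 / y) / e := by
      rw [hw', show 2 / ((e : ℝ) ^ 2 * y) = (2 / y) / (e : ℝ) ^ 2 by field_simp,
        Real.sqrt_div' _ (by positivity), Real.sqrt_sq he0.le]
    rw [h1, div_le_iff₀ he0]
    have h2 : (N : ℝ) < ((N / e : ℕ) + 1) * e := by
      have : N < (N / e + 1) * e := by rw [mul_comm]; exact Nat.lt_mul_div_succ N he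
      exact_mod_cast this
    linarith
  set K : ℝ := (2 * C_M * C_b / α) * (2 / w') ^ (α / 2) with hK
  have hK0 : 0 ≤ K := by positivity
  have hterm : ∀ j : ℤ, ‖(if j = 0 then (0 : ℂ) else
      ∑ d ∈ Finset.Ioc 0 (N / e), (μ d : ℂ) * arcCoeff g (j * e) ((d : ℝ) ^ 2 * w'))‖ ≤
      K * ((e : ℝ) ^ 3)⁻¹ * (if j = 0 then (0 : ℝ) else 1 / |(j : ℝ)| ^ 3) := by
    intro j
    split_ifs with hj
    · simp
    · have hje : (j * e : ℤ) ≠ 0 := mul_ne_zero hj (by exact_mod_cast he.ne')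
      refine (norm_sum_moebius_arcCoeff_le hg hCb0 hCb hCM hα0 hM hje hw'0 hn).trans (le_of_eq ?_)
      rw [hK]
      have : |((j * e : ℤ) : ℝ)| ^ 3 = |(j : ℝ)| ^ 3 * (e : ℝ) ^ 3 := by
        push_cast
        rw [abs_mul, abs_of_pos he0, mul_pow]
      rw [this]
      field_simp
  have hS : HasSum (fun j : ℤ => K * ((e : ℝ) ^ 3)⁻¹ * (if j = 0 then (0 : ℝ) else 1 / |(j : ℝ)| ^ 3))
      (K * ((e : ℝ) ^ 3)⁻¹ * ∑' j : ℤ, (if j = 0 then (0 : ℝ) else 1 / |(j : ℝ)| ^ 3)) := by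
    refine (Summable.hasSum ?_).mul_left _
    refine Summable.of_nonneg_of_le (fun j => by split_ifs <;> positivity) (fun j => ?_)
      IsStripFun.summable_one_div_abs_int_cube
    split_ifs <;> simp
  have htsum := tsum_of_norm_bounded hS hterm
  refine (mul_le_mul_of_nonneg_left htsum (Nat.cast_nonneg e)).trans ?_
  have h4 := tsum_inv_abs_cube_le
  -- `(2/w')^{α/2} = 2^{α/2} e^{-α} y^{-α/2} ≤ 2 y^{-α/2}`
  have hpow : (2 / w') ^ (α / 2) ≤ 2 * y ^ (-(α / 2)) := by
    rw [hw', show (2 : ℝ) / ((e : ℝ) ^ 2 * y) = (2 / (e : ℝ) ^ 2) * y⁻¹ by field_simp,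
      Real.mul_rpow (by positivity) (by positivity), Real.inv_rpow hy.le, ← Real.rpow_neg hy.le]
    gcongr
    calc (2 / (e : ℝ) ^ 2) ^ (α / 2) ≤ (2 : ℝ) ^ (α / 2) := by
          apply Real.rpow_le_rpow (by positivity) _ (by positivity)
          rw [div_le_iff₀ (by positivity)]
          have : (1 : ℝ) ≤ (e : ℝ) ^ 2 := one_le_pow₀ (by exact_mod_cast he)
          nlinarith
      _ ≤ (2 : ℝ) ^ (1 : ℝ) := Real.rpow_le_rpow_of_exponent_le one_le_two (by linarith)
      _ = 2 := Real.rpow_one 2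
  calc (e : ℝ) * (K * ((e : ℝ) ^ 3)⁻¹ * ∑' j : ℤ, (if j = 0 then (0 : ℝ) else 1 / |(j : ℝ)| ^ 3))
      ≤ (e : ℝ) * (K * ((e : ℝ) ^ 3)⁻¹ * 4) := by gcongr
    _ = 4 * K * ((e : ℝ) ^ 2)⁻¹ := by field_simp
    _ = 4 * (2 * C_M * C_b / α) * (2 / w') ^ (α / 2) * ((e : ℝ) ^ 2)⁻¹ := by rw [hK]; ring
    _ ≤ 4 * (2 * C_M * C_b / α) * (2 * y ^ (-(α / 2))) * ((e : ℝ) ^ 2)⁻¹ := by gcongr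
    _ = (16 * C_M * C_b / α) * ((e : ℝ) ^ 2)⁻¹ * y ^ (-(α / 2)) := by ring

/-- **All nonzero modes**: `‖∑_{e ≤ N} ∑_{d ≤ N/e} μ(d) e T_e((ed)²y)‖ ≤ (32 C_M C_b/α) y^{-α/2}`
(`∑_e e⁻² ≤ 2`). [folklore] -/
theorem norm_nonzero_modes_le (hg : IsStripFun Y₁ g) {C_b : ℝ} (hCb0 : 0 ≤ C_b)
    (hCb : ∀ k : ℤ, k ≠ 0 → ∀ w : ℝ, 0 < w →
      ∃ D : ℂ, HasDerivAt (arcCoeff g k) D w ∧ ‖D‖ ≤ C_b / (|(k : ℝ)| ^ 3 * w))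
    {C_M α : ℝ} (hCM : 0 ≤ C_M) (hα0 : 0 < α) (hα1 : α ≤ 1)
    (hM : ∀ t : ℝ, 1 ≤ t → |∑ n ∈ Finset.Icc 0 ⌊t⌋₊, (μ n : ℝ)| ≤ C_M * t ^ α)
    {y : ℝ} (hy : 0 < y) {N : ℕ} (hN : Real.sqrt (2 / y) ≤ N) :
    ‖∑ e ∈ Finset.Ioc 0 N, ∑ d ∈ Finset.Ioc 0 (N / e),
        (μ d : ℂ) * ((e : ℂ) * tail g e (((e * d : ℕ) : ℝ) ^ 2 * y))‖ ≤
      (32 * C_M * C_b / α) * y ^ (-(α / 2)) := by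
  refine (norm_sum_le _ _).trans ?_
  have hrow : ∀ e ∈ Finset.Ioc 0 N, ‖∑ d ∈ Finset.Ioc 0 (N / e),
      (μ d : ℂ) * ((e : ℂ) * tail g e (((e * d : ℕ) : ℝ) ^ 2 * y))‖ ≤
      (16 * C_M * C_b / α) * y ^ (-(α / 2)) * ((e : ℝ) ^ 2)⁻¹ := fun e he => by
    have := norm_row_tail_le hg hCb0 hCb hCM hα0 hα1 hM hy hN (Finset.mem_Ioc.mp he).1
    linarith [this]
  refine (Finset.sum_le_sum hrow).trans ?_
  rw [← Finset.mul_sum]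
  have h2 : ∑ e ∈ Finset.Ioc 0 N, ((e : ℝ) ^ 2)⁻¹ ≤ 2 := by
    have h := sum_Ioo_inv_sq_le (α := ℝ) 0 (N + 1)
    rw [show Finset.Ioo 0 (N + 1) = Finset.Ioc 0 N by
      ext; simp only [Finset.mem_Ioo, Finset.mem_Ioc]; omega] at h
    norm_num at h
    exact h
  have h0 : 0 ≤ (16 * C_M * C_b / α) * y ^ (-(α / 2)) := by positivity
  calc (16 * C_M * C_b / α) * y ^ (-(α / 2)) * ∑ e ∈ Finset.Ioc 0 N, ((e : ℝ) ^ 2)⁻¹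
      ≤ (16 * C_M * C_b / α) * y ^ (-(α / 2)) * 2 := by gcongr
    _ = (32 * C_M * C_b / α) * y ^ (-(α / 2)) := by ring

/-! ### The zero mode -/

/-- The zero-mode kernel `k₀(l) = ∫_{-3}^{3} ∫₀¹ g(x + i/(l²+s²)) dx ds` of
`HorocycleZeroKernel.lean` (with `a = 1/2`, `S = 1 + 1/a = 3`). [folklore] -/
def zeroKernel (g : ℂ → ℂ) (l : ℝ) : ℂ :=
  ∫ s in (-(1 + 1 / (1 / 2 : ℝ)))..(1 + 1 / (1 / 2 : ℝ)),
    ∫ x in (0:ℝ)..1, g (x + (1 / (l ^ 2 + s ^ 2) : ℝ) * I)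

/-- `k₀` is `C³` (indeed smooth, `HorocycleZeroKernel.contDiff_zeroKernel`). [folklore] -/
theorem contDiff_three_zeroKernel (hg : IsStripFun Y₁ g) : ContDiff ℝ 3 (zeroKernel g) := by
  have h := HorocycleZeroKernel.contDiff_zeroKernel hg.contDiff hg.supp' (a := 1 / 2)
    (b := max Y₁ (1 / 2)) (by norm_num) (le_max_right _ _) (1 + 1 / (1 / 2 : ℝ))
  unfold zeroKernel
  simpa using contDiff_infty.mp h 3

/-- `k₀ = 0` on `[2, ∞)`. [folklore] -/
theorem zeroKernel_eq_zero (hg : IsStripFun Y₁ g) {l : ℝ} (hl : 2 ≤ l) : zeroKernel g l = 0 :=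
  hg.zeroKernel_eq_zero_of_two_le hl

/-- **The zero mode**: `u b₀(u²) = k₀(u)` for `u > 0`
(`HorocycleZeroKernel.mul_coeffPsi_zero_eq`). [folklore] -/
theorem mul_arcCoeff_zero (hg : IsStripFun Y₁ g) {u : ℝ} (hu : 0 < u) :
    (u : ℂ) * arcCoeff g 0 (u ^ 2) = zeroKernel g u := by
  rw [arcCoeff_eq_coeff hg (pow_pos hu 2) 0]
  exact HorocycleZeroKernel.mul_coeffPsi_zero_eq hg.contDiff.continuous hg.periodic hg.supp'
    (a := 1 / 2) (by norm_num) hu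

/-! ### The rate for a strip test function -/

/-- **Core estimate.** Let `g` be a strip test function and `|M(t)| ≤ C_M t^α` (`t ≥ 1`,
`1/2 ≤ α < 1`). With `S = ∑ μ(d)/d²`, `I₀ = ∫₀² k₀` and `N = ⌈2/√y⌉₊`, for `0 < y < 1/2`:
`‖2y ∑_{c ≤ N} ∑_{a mod c}^* Φ_g(c²y, a/c) - 2 S I₀‖ ≤ K y^{1-α/2}`. [folklore] -/
theorem rate_core (hg : IsStripFun Y₁ g) {C_M α : ℝ} (hCM : 0 ≤ C_M) (hα0 : 1 / 2 ≤ α)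
    (hα1 : α < 1) (hM : ∀ t : ℝ, 1 ≤ t → |∑ n ∈ Finset.Icc 0 ⌊t⌋₊, (μ n : ℝ)| ≤ C_M * t ^ α) :
    ∃ K : ℝ, 0 ≤ K ∧ ∀ y : ℝ, 0 < y → y < 1 / 2 →
      ‖2 * (y : ℂ) * ∑ c ∈ Finset.Ioc 0 ⌈2 / Real.sqrt y⌉₊,
          ∑ a ∈ (Finset.range c).filter (fun a => Nat.Coprime c a),
            arcTransform g ((c : ℝ) ^ 2 * y) ((a : ℝ) / c) -
        2 * (∑' d : ℕ, (μ d : ℂ) / (d : ℂ) ^ 2) * ∫ s in (0 : ℝ)..2, zeroKernel g s‖ ≤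
        K * y ^ (1 - α / 2) := by
  have hα0' : 0 < α := by linarith
  obtain ⟨C_b, hCb0, hCb⟩ := exists_bound_hasDerivAt_arcCoeff hg
  obtain ⟨C_Z, hCZ⟩ := zeroMode_bound_rpow (contDiff_three_zeroKernel hg) two_pos
    (fun s hs => zeroKernel_eq_zero hg hs) hCM hα0' hα1 hM
  set S : ℂ := ∑' d : ℕ, (μ d : ℂ) / (d : ℂ) ^ 2 with hS
  set I₀ : ℂ := ∫ s in (0 : ℝ)..2, zeroKernel g s with hI₀
  -- `C_Z ≥ 0` (test the bound at `l = 1`, `N = 2`)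
  have hCZ0 : 0 ≤ C_Z := by
    have h := hCZ 1 one_pos (by norm_num) 2 (by norm_num)
    rw [Real.one_rpow, mul_one] at h
    exact (norm_nonneg _).trans h
  refine ⟨2 * C_Z + 64 * C_M * C_b / α, by positivity, fun y hy0 hy2 => ?_⟩
  have hy1 : y < 1 := by linarith
  obtain ⟨hl, hl1, hsq, hlN, hNle, hN2⟩ := rows_aux hy0 hy1
  set l : ℝ := Real.sqrt y with hl_def
  set N : ℕ := ⌈2 / l⌉₊ with hN_def
  -- the rows: zero mode + nonzero modes
  have hrows : ∑ c ∈ Finset.Ioc 0 N, ∑ a ∈ (Finset.range c).filter (fun a => Nat.Coprime c a),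
      arcTransform g ((c : ℝ) ^ 2 * y) ((a : ℝ) / c) =
      ∑ c ∈ Finset.Ioc 0 N, (Nat.totient c : ℂ) * arcCoeff g 0 ((c : ℝ) ^ 2 * y) +
        ∑ e ∈ Finset.Ioc 0 N, ∑ d ∈ Finset.Ioc 0 (N / e),
          (μ d : ℂ) * ((e : ℂ) * tail g e (((e * d : ℕ) : ℝ) ^ 2 * y)) := by
    rw [← sum_sum_divisors_eq, ← Finset.sum_add_distrib]
    refine Finset.sum_congr rfl fun c hc => ?_
    have hc0 : 0 < c := (Finset.mem_Ioc.mp hc).1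
    exact sum_coprime_arcTransform hg (by positivity) hc0
  -- the zero mode in terms of `k₀`
  have hzero : ∑ c ∈ Finset.Ioc 0 N, (Nat.totient c : ℂ) * arcCoeff g 0 ((c : ℝ) ^ 2 * y) =
      (1 / (l : ℂ)) * ∑ c ∈ Finset.Ioc 0 N, ((Nat.totient c : ℂ) / c) * zeroKernel g (l * c) := by
    rw [Finset.mul_sum]
    refine Finset.sum_congr rfl fun c hc => ?_
    have hc0 : 0 < c := (Finset.mem_Ioc.mp hc).1
    have hc0' : (0 : ℝ) < c := by exact_mod_cast hc0
    have hlc : 0 < l * c := mul_pos hl hc0'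
    have hk := mul_arcCoeff_zero hg hlc
    have e1 : (l * c) ^ 2 = (c : ℝ) ^ 2 * y := by rw [mul_pow, hsq]; ring
    rw [e1] at hk
    rw [← hk]
    have hl0 : (l : ℂ) ≠ 0 := by exact_mod_cast hl.ne'
    have hc0'' : (c : ℂ) ≠ 0 := by exact_mod_cast hc0.ne'
    push_cast
    field_simp
  have hZ := hCZ l hl (by linarith) N hlN
  -- the two estimates
  have hl0 : (l : ℂ) ≠ 0 := by exact_mod_cast hl.ne'
  have hyl : (y : ℂ) = (l : ℂ) ^ 2 := by rw [← hsq]; push_cast; ring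
  have hzeroErr : ‖2 * (y : ℂ) * ∑ c ∈ Finset.Ioc 0 N, (Nat.totient c : ℂ) * arcCoeff g 0 ((c : ℝ) ^ 2 * y) -
      2 * S * I₀‖ ≤ 2 * C_Z * y ^ (1 - α / 2) := by
    have key : 2 * (y : ℂ) * ∑ c ∈ Finset.Ioc 0 N, (Nat.totient c : ℂ) * arcCoeff g 0 ((c : ℝ) ^ 2 * y) -
        2 * S * I₀ = 2 * (l : ℂ) * (∑ c ∈ Finset.Ioc 0 N, ((Nat.totient c : ℂ) / c) * zeroKernel g (l * c) -
          S * I₀ / l) := by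
      rw [hzero, hyl]
      field_simp
    rw [key, norm_mul, norm_mul, Complex.norm_ofNat, Complex.norm_real, Real.norm_of_nonneg hl.le]
    have hpow : l * l ^ (1 - α) = y ^ (1 - α / 2) := by
      rw [← hsq, ← Real.rpow_natCast l 2, ← Real.rpow_mul hl.le,
        show ((2 : ℕ) : ℝ) * (1 - α / 2) = 1 + (1 - α) by push_cast; ring,
        Real.rpow_one_add' hl.le (by linarith)]
    calc 2 * l * ‖∑ c ∈ Finset.Ioc 0 N, ((Nat.totient c : ℂ) / c) * zeroKernel g (l * c) - S * I₀ / l‖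
        ≤ 2 * l * (C_Z * l ^ (1 - α)) := by gcongr
      _ = 2 * C_Z * (l * l ^ (1 - α)) := by ring
      _ = 2 * C_Z * y ^ (1 - α / 2) := by rw [hpow]
  have hnonzero : ‖2 * (y : ℂ) * ∑ e ∈ Finset.Ioc 0 N, ∑ d ∈ Finset.Ioc 0 (N / e),
      (μ d : ℂ) * ((e : ℂ) * tail g e (((e * d : ℕ) : ℝ) ^ 2 * y))‖ ≤
      (64 * C_M * C_b / α) * y ^ (1 - α / 2) := by
    rw [norm_mul, norm_mul, Complex.norm_ofNat, Complex.norm_real, Real.norm_of_nonneg hy0.le]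
    have h := norm_nonzero_modes_le hg hCb0 hCb hCM hα0' hα1.le hM hy0 hN2
    have hpow : y * y ^ (-(α / 2)) = y ^ (1 - α / 2) := by
      rw [show (1 : ℝ) - α / 2 = 1 + -(α / 2) by ring, Real.rpow_one_add' hy0.le (by linarith)]
    calc 2 * y * ‖∑ e ∈ Finset.Ioc 0 N, ∑ d ∈ Finset.Ioc 0 (N / e),
          (μ d : ℂ) * ((e : ℂ) * tail g e (((e * d : ℕ) : ℝ) ^ 2 * y))‖
        ≤ 2 * y * ((32 * C_M * C_b / α) * y ^ (-(α / 2))) := by gcongr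
      _ = (64 * C_M * C_b / α) * (y * y ^ (-(α / 2))) := by ring
      _ = (64 * C_M * C_b / α) * y ^ (1 - α / 2) := by rw [hpow]
  -- assemble
  rw [hrows]
  set A : ℂ := ∑ c ∈ Finset.Ioc 0 N, (Nat.totient c : ℂ) * arcCoeff g 0 ((c : ℝ) ^ 2 * y) with hA
  set B : ℂ := ∑ e ∈ Finset.Ioc 0 N, ∑ d ∈ Finset.Ioc 0 (N / e),
    (μ d : ℂ) * ((e : ℂ) * tail g e (((e * d : ℕ) : ℝ) ^ 2 * y)) with hB
  have e : 2 * (y : ℂ) * (A + B) - 2 * S * I₀ = (2 * (y : ℂ) * A - 2 * S * I₀) + 2 * (y : ℂ) * B := by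
    ring
  rw [e]
  calc ‖(2 * (y : ℂ) * A - 2 * S * I₀) + 2 * (y : ℂ) * B‖
      ≤ ‖2 * (y : ℂ) * A - 2 * S * I₀‖ + ‖2 * (y : ℂ) * B‖ := norm_add_le _ _
    _ ≤ 2 * C_Z * y ^ (1 - α / 2) + (64 * C_M * C_b / α) * y ^ (1 - α / 2) :=
        add_le_add hzeroErr hnonzero
    _ = (2 * C_Z + 64 * C_M * C_b / α) * y ^ (1 - α / 2) := by ring

end HorocycleRHQuasiRH

/-! ### Discharge of the named fact -/

open HorocycleRHQuasiRH in
/-- **Zagier 1981, §1 p. 279, (Z1) — quasi-RH ⇒ horocycle equidistribution with power saving,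
PROVED**: discharge of the named fact `horocycleRate_of_quasiRH` (`HorocycleRH.lean`). For
`θ = 1/2` the hypothesis is vacuous and the conclusion is the unconditional rate
(`horocycleRate_half`); for `1/2 < θ ≤ 3/4`, `QuasiRiemannHypothesis (2-2θ)` gives
`M(x) = O(x^{2-2θ+ε'})` (Titchmarsh Thm. 14.25, tree) and the elementary unfolding argument
(`rate_core`) gives `∫₀¹ F(x+iy) dx - c = O(y^{θ-ε'/2})`, `c = 2 (∑ μ(d)/d²) ∫₀² k₀`.
[cite: Zagier1981, §1 p. 279 (Z1: C(F;y) = κ + O(y^{1−Θ/2−ε}))] -/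
theorem horocycleRate_of_quasiRH_holds : horocycleRate_of_quasiRH := by
  intro θ h₁ h₂ hQ
  rcases h₁.eq_or_lt with h | h
  · rw [← h]; exact horocycleRate_half
  · intro F hF hinv hsupp
    obtain ⟨Y, hY⟩ := hsupp
    obtain ⟨g, hg, hunf⟩ := HorocycleUnfolding_holds F hF hinv Y hY
    refine ⟨2 * (∑' d : ℕ, (μ d : ℂ) / (d : ℂ) ^ 2) * ∫ s in (0 : ℝ)..2, zeroKernel g s,
      fun ε hε => ?_⟩
    -- parameters: `α = 2 - 2θ + ε'`, `ε' = min ε ((2θ-1)/2)`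
    set ε' : ℝ := min ε ((2 * θ - 1) / 2) with hε'
    have hε'0 : 0 < ε' := lt_min hε (by linarith)
    have hε'ε : ε' ≤ ε := min_le_left _ _
    have hε'θ : ε' ≤ (2 * θ - 1) / 2 := min_le_right _ _
    obtain ⟨C_M, hCM0, hM⟩ := MoebiusDilatedSums.exists_mertens_bound_of_quasiRH
      (θ₀ := 2 - 2 * θ) (by linarith) (by linarith) hQ hε'0
    obtain ⟨K, hK0, hK⟩ := rate_core hg hCM0 (α := 2 - 2 * θ + ε') (by linarith) (by linarith) hM
    refine IsBigO.of_bound K ?_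
    filter_upwards [Ioo_mem_nhdsGT (show (0 : ℝ) < 1 / 2 by norm_num)] with y hy
    obtain ⟨hy0, hy2⟩ := hy
    have hy1 : y < 1 := by linarith
    obtain ⟨-, -, -, -, -, hN2⟩ := rows_aux hy0 hy1
    rw [hunf y hy0 hy2 _ hN2]
    refine (hK y hy0 hy2).trans ?_
    rw [Real.norm_of_nonneg (Real.rpow_nonneg hy0.le _)]
    exact mul_le_mul_of_nonneg_left (Real.rpow_le_rpow_of_exponent_ge hy0 hy1.le (by linarith)) hK0

/-- **The dictionary, unconditionally**: for `θ ∈ [1/2, 3/4]`,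
`HorocycleRate θ ↔ QuasiRiemannHypothesis (2 - 2θ)` — both directions of Zagier's dictionary are
now theorems of the tree (`horocycleRate_of_quasiRH_holds`, `quasiRH_of_horocycleRate_holds`).
[cite: Zagier1981, §1 pp. 279–280] -/
theorem horocycleRate_iff_quasiRH {θ : ℝ} (h₁ : 1 / 2 ≤ θ) (h₂ : θ ≤ 3 / 4) :
    HorocycleRate θ ↔ QuasiRiemannHypothesis (2 - 2 * θ) :=
  ⟨quasiRH_of_horocycleRate_holds θ h₁ h₂, horocycleRate_of_quasiRH_holds θ h₁ h₂⟩

/-- **Zagier's criterion, unconditionally**: closed horocycles on `SL(2,ℤ)\ℍ` equidistribute with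
rate `O_ε(y^{3/4-ε})` for every smooth compactly supported observable **iff** the Riemann
hypothesis holds (`horocycleRate_threeQuarters_iff_of` fed with the three discharged facts).
[cite: Zagier1981, §1 p. 279 ("then the Riemann hypothesis is true!")] -/
theorem horocycleRate_threeQuarters_iff_riemannHypothesis :
    HorocycleRate (3 / 4) ↔ RiemannHypothesis :=
  horocycleRate_threeQuarters_iff_of horocycleRate_of_quasiRH_holds quasiRH_of_horocycleRate_holds
    quasiRiemannHypothesis_one_half_iff_holds

end Literature.NumberTheory.LFunctions

end
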